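/-
Copyright (c) 2026 the pub-hodgecm-mathlib formalisation cell (harness21).  Prover seat hodgecm-mathlib-K2E2-p12 (g10), Track B «K2-LIT», h413 = `stmt-HodgeConjecture-24833`,
route `HCCMUnconditional`; R90-TF section S8 «ContSpec-n½», deal S8-R221 (1) (S8 dealer R90-CS-plan (g3); ruling J-S8-♭ S8-R223 (2)), (E6-T): TRANSPORT of the (E6) truncated `L²`
family of one export package to another continuation of the same Eisenstein series — the NAMED `midWitnessEc ∕ midWitnessP` of record being the target — GLOBALLY off the target's
pole set and LETTER-FREE, thanks to K2E1-p11 (g5)'s ★ p864577 letter-free shrink (census `R90/S8/CENSUS-Transport.K2E2-p12-g10.md` 39738f643399dde2, finding (T3) SUPERSEDED — see below).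
-/
import Summits.HodgeConjecture.HodgeConjecture.Theorems.K2E1ChiTruncatedFamilyRemovableFreeCMThree                   -- ★ p864577 (K2E1-p11): `truncatedFamily_removable_on_of_rows` (the LOCALISED letter-free pole-set shrink; (MS-P′) from the rows by Cauchy on squares)
import Summits.HodgeConjecture.HodgeConjecture.Theorems.K2E1ChiEisensteinLeftInvarianceOffPolesCMThree                -- ★ p864271 (K2E1-p16): `eq_of_codiscrete_of_eqOn_re_gt` (identity theorem off a co-discrete set), `hEcinv_of_codiscrete`; brings ★ p864008 `midWitnessExports_spec`
import Summits.HodgeConjecture.HodgeConjecture.Theorems.K2E1ChiEisensteinMeromorphicExportsWithTruncatedFamilyCMThree   -- ★ p863930 (K2E1-p10): the SOURCE package with (E6) `chiEisenstein_meromorphic_exports_level_cm_three_with_truncatedFamily`; brings ★ `one_apply_torus`, `isAutomorphic_one`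
import HarnessLib

/-!
# h413 ∕ R90-S8 — `K2E1ChiTruncatedFamilyTransportCMThree` ((E6-T)): TRANSPORT OF THE (E6) TRUNCATED `L²` FAMILY BETWEEN TWO CONTINUATIONS OF THE SAME χ-EISENSTEIN SERIES —
# identity theorem off `P ∪ P′`, then LETTER-FREE removal of the foreign candidates `P′ ∖ P`; the named instance `hE6_midWitness`

Cell `pub/hodgecm-mathlib`, crux H413 = `stmt-HodgeConjecture-24833`, route `HCCMUnconditional`; R90-TF section S8, deal S8-R221 (1); K2E1-p16 (g3)'s (V) LEDGER 5e21725b4bac9bd5 rows 3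
and 6 (`hE6`, `Fam hFd hFam`).  THEOREMS ONLY (no `def`, no `instance`, no notation, no named-fact hypothesis, no `sorry`; default heartbeats); lane `--supports
stmt-HodgeConjecture-24833 --as helper` (count-neutral).  Closes no socket.

THE MATHEMATICS ([MoeglinWaldspurger1995, IV.1.9–IV.1.11]; [BernsteinLapid2019, Thm 2.3, §4 p. 10]; [Conway1978, IV §3 Thm 3.7, V §1]).  Two export packages of the χ-Eisenstein engine for the
SAME section `φ` — ★ p863930 `(Ec′, P′)` WITH its (E6) truncated `L²` family `Fam′` (holomorphic on `ℂ ∖ P′`, `Fam′ z =ᵐ Λ^T(Ec′ z)` off `P′`), and the NAMED package of record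
`(Ec, P) = (midWitnessEc, midWitnessP)` (★ p864008, chosen from ★ p863590, WITHOUT (E6)) — are a priori INDEPENDENT choices (two runs of the Bernstein–Lapid machine).  (T1) Pointwise in `g`
both `Ec · g`, `Ec′ · g` are analytic off the closed co-discrete sets and equal to `E(φ_z)(g)` on the tube, so `Ec′ z = Ec z` for every `z ∉ P ∪ P′` (★ p864271's identity theorem off a
co-discrete set; unions of co-discrete sets are co-discrete): `Fam′` represents `Λ^T(Ec z)` a.e. at every `z ∈ Pᶜ ∖ P′` and is holomorphic there.  (T2) The FOREIGN candidates `P′ ∖ P` are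
REMOVABLE WITHOUT ANY LETTER: on the open set `U := Pᶜ` the TARGET carries the pointwise rows — `Ec · g` holomorphic (`hEan`), `Ec z` continuous (`hE4`), locally jointly bounded (`hEbd`),
left-`G(F)`-invariant (★ `hEcinv_of_codiscrete` from the tube automorphy) — and K2E1-p11's ★ `truncatedFamily_removable_on_of_rows` (Cauchy's formula on the SQUARES of the pointwise
holomorphic representative + Tonelli ⇒ the `L²` family is bounded near each foreign candidate ⇒ Riemann in `L²` with the right a.e. value) extends `Fam′` to a family holomorphic on ALL of
`Pᶜ` representing `Λ^T(Ec z)` a.e. at EVERY `z ∉ P`.  So (E6) holds for the named package GLOBALLY off `midWitnessP` — the (V) OF RECORD's `hE6` and `Fam hFd hFam` exactly as typed (no ♭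
needed for them; my census' (T3) «out of reach for `Re ≤ 1`» concerned the Maass–Selberg road and is superseded by ★ p864577).  What the Maass–Selberg road (★ p864107 ∕ p864145 ∕
p864494, this lineage) still pays is (MS-P′) at the TRUE candidates `z₀ ∈ P`, `1 < Re z₀` — `hMSP′`, modulo the scalar half there; it applies verbatim to the transported family.
* §1 `codiscrete_union`, `continuation_eq_of_codiscrete` ((T1), function-valued).
* §2 HEAD **`truncatedFamily_transport_of_exports`** (generic OF CLAUSES, CM `N = 3`): TARGET `(Ec, P)` with `hE2 hPc hPcd hEan hE4 hEbd` (clauses 5, 7, 8, 10, 14, 15 of ★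
  `midWitnessExports_spec`), the pair-section data `hφ hχ₂` (for the invariance), SOURCE `(Ec′, P′, Fam′)` with `hE2′ hPc′ hPcd′ hEan′ hFd′ hFam′` ⊢
  `∃ Fam, DifferentiableOn ℂ Fam Pᶜ ∧ ∀ z ∉ P, ⇑(Fam z) =ᵐ[μ] quotFun (Λ^T (Ec z))` — (E6) for the target, VERBATIM ★ p863930's conjunct shape.
* §3 NAMED INSTANCE **`hE6_midWitness`**: ★ `midWitnessExports_spec`'s binders VERBATIM + the level `T ≥ 1` ⊢ (E6) for `(midWitnessEc, midWitnessP)` — the (V) OF RECORD's letter `hE6`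
  IS `fun T hT => (hE6_midWitness … hT).imp fun _ h => h.2`, and `Fam hFd hFam` on its row-(ii) domain `D ⊆ midWitnessPᶜ` are `obtain`ed from it (★W).
HONEST LABEL: HC_CM is proved only modulo the 7 printed citations (2 remaining named inputs: hLiu418 = `stmt-HodgeConjecture-24832`, h413 = `stmt-HodgeConjecture-24833`) until rung 0
closes; this file asserts no named fact and closes no socket; (E6) at the named family becomes ★W — `hMSP′` (true candidates), `hMS32`, the ℓ-CT rows, `hsrc` stay with their owners; count-neutral.

## References
* [MoeglinWaldspurger1995] C. Mœglin, J.-L. Waldspurger, *Spectral Decomposition and Eisenstein Series* (1995), IV.1.9–IV.1.11.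
* [BernsteinLapid2019] J. Bernstein, E. Lapid, *On the meromorphic continuation of Eisenstein series*, J. AMS 37 (2024), Thm 2.3, §4 (p. 10).
* [Conway1978] J. B. Conway, *Functions of One Complex Variable I*, 2nd ed. (1978), IV §3 Thm 3.7, V §1.
-/

set_option autoImplicit false
set_option linter.dupNamespace false  -- the mandated namespace repeats the summit's segment (`HodgeConjecture.HodgeConjecture`)

noncomputable section

open MeasureTheory Measure NumberField IsDedekindDomain Set Filter Topology
open scoped ENNReal NNReal
open Literature.MeasureTheory.Group Literature.NumberTheory Literature.NumberTheory.Automorphic Literature.NumberTheory.Automorphic.UnitaryGroup Literature.NumberTheory.GaloisRepresentations AdelicGroupData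
open Literature.NumberTheory.Automorphic.Arthur2013.Leaves.TECR Literature.NumberTheory.Rogawski1990
open Summit.HodgeConjecture.HodgeConjecture.Cruxes.H413.K2E1BorelEisensteinU Summit.HodgeConjecture.HodgeConjecture.Cruxes.H413.K2E1CharacterEisensteinU2Defs
open Summit.HodgeConjecture.HodgeConjecture.Cruxes.H413.K2E1CharacterEisensteinU3PairDefs Summit.HodgeConjecture.HodgeConjecture.Cruxes.H413.K2E1BLBorelSpacesU2Defs
open Summit.HodgeConjecture.HodgeConjecture.Cruxes.H413.K2E1ChiSectionSpaceU2Defs (chiSectionSpace isChiSection_of_mem)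
open Summit.HodgeConjecture.HodgeConjecture.Cruxes.H413.K2E1ChiTruncatedFamilyRemovableFreeCMThree (truncatedFamily_removable_on_of_rows)
open Summit.HodgeConjecture.HodgeConjecture.Cruxes.H413.K2E1ChiEisensteinLeftInvarianceOffPolesCMThree (eq_of_codiscrete_of_eqOn_re_gt hEcinv_of_codiscrete)
open Summit.HodgeConjecture.HodgeConjecture.Cruxes.H413.K2E1ChiEisensteinMeromorphicExportsM1CMThree (one_apply_torus isAutomorphic_one)
open Summit.HodgeConjecture.HodgeConjecture.Cruxes.H413.K2E1ChiEisensteinMeromorphicExportsWithTruncatedFamilyCMThree (chiEisenstein_meromorphic_exports_level_cm_three_with_truncatedFamily)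
open Summit.HodgeConjecture.HodgeConjecture.R90.S8 (midWitnessEc midWitnessP midWitnessExports_spec)

namespace Summit.HodgeConjecture.HodgeConjecture.Cruxes.H413.K2E1ChiTruncatedFamilyTransportCMThree

/-! ## §1 Generic bookkeeping: unions of co-discrete sets; the identity theorem for function-valued continuations -/

section Generic

/-- A union of two co-discrete subsets of `ℂ` is co-discrete. [folklore] -/
theorem codiscrete_union {P P' : Set ℂ} (hP : ∀ z₀ : ℂ, ∀ᶠ s in 𝓝[≠] z₀, s ∉ P) (hP' : ∀ z₀ : ℂ, ∀ᶠ s in 𝓝[≠] z₀, s ∉ P') (z₀ : ℂ) :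
    ∀ᶠ s in 𝓝[≠] z₀, s ∉ P ∪ P' := by
  filter_upwards [hP z₀, hP' z₀] with s hs hs' h
  exact h.elim hs hs'

/-- **THE IDENTITY THEOREM FOR TWO CONTINUATIONS OF THE SAME FAMILY OF FUNCTIONS** ((T1)): if `Ec · g` and `Ec′ · g` are analytic off the co-discrete sets `P`, `P′` for every `g` and
`Ec z = Ec′ z` on a right half-plane `{b < Re}`, then `Ec z = Ec′ z` (as functions of `g`) for every `z ∉ P ∪ P′` (★ `eq_of_codiscrete_of_eqOn_re_gt` pointwise in `g`).
[cite: Conway1978, IV §3 Thm 3.7] [cite: MoeglinWaldspurger1995, IV.1.11] -/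
theorem continuation_eq_of_codiscrete {X : Type*} {Ec Ec' : ℂ → X → ℂ} {P P' : Set ℂ}
    (hPcd : ∀ z₀ : ℂ, ∀ᶠ s in 𝓝[≠] z₀, s ∉ P) (hPcd' : ∀ z₀ : ℂ, ∀ᶠ s in 𝓝[≠] z₀, s ∉ P')
    (hEan : ∀ g (z : ℂ), z ∉ P → AnalyticAt ℂ (fun z => Ec z g) z) (hEan' : ∀ g (z : ℂ), z ∉ P' → AnalyticAt ℂ (fun z => Ec' z g) z)
    {b : ℝ} (hagree : ∀ z : ℂ, b < z.re → Ec z = Ec' z) {z : ℂ} (hz : z ∉ P) (hz' : z ∉ P') : Ec z = Ec' z := by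
  funext g
  exact eq_of_codiscrete_of_eqOn_re_gt (codiscrete_union hPcd hPcd') (u := fun z => Ec z g) (v := fun z => Ec' z g)
    (fun w hw => hEan g w fun h => hw (Or.inl h)) (fun w hw => hEan' g w fun h => hw (Or.inr h)) (fun w hw => congrFun (hagree w hw) g)
    (show z ∉ P ∪ P' from fun h => h.elim hz hz')

end Generic

/-! ## §2 HEAD: the transport of the (E6) family between two export packages — globally off the target's pole set, letter-free -/

section Transport
variable (L : Type) [Field L] [NumberField L] [IsCMField L] [MeasurableSpace (quasiSplit (↥(maximalRealSubfield L)) L (IsCMField.complexConj L) 3).Adelic] [BorelSpace (quasiSplit (↥(maximalRealSubfield L)) L (IsCMField.complexConj L) 3).Adelic]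

/-- **(E6-T) — TRANSPORT OF THE TRUNCATED `L²` FAMILY TO ANOTHER CONTINUATION OF THE SAME EISENSTEIN SERIES, GLOBALLY OFF THE TARGET'S POLE SET** (module docstring).  `μ` s-finite,
`ν` Haar on `N(𝔸)` with a fundamental domain `𝓕` of compact closure, `T ≥ 1`; a `(χ₁, χ₂)`-pair-section `φ` with `χ₂` automorphic (left-`G(F)`-invariance of the continuation off the poles,
★ `hEcinv_of_codiscrete`).  TARGET package `(Ec, P)`: tube identity `hE2`, `P` closed co-discrete, `Ec · g` analytic off `P` (`hEan`), `Ec z` continuous and locally jointly bounded off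
`P` (`hE4`, `hEbd`).  SOURCE package `(Ec′, P′)` (tube identity, `P′` closed co-discrete, `Ec′ · g` analytic off `P′`) with its (E6) family `Fam′` at level `T`.  THEN
`∃ Fam : ℂ → L²(μ)`, `DifferentiableOn ℂ Fam Pᶜ ∧ ∀ z ∉ P, ⇑(Fam z) =ᵐ[μ] quotFun (Λ^T (Ec z))` — (E6) for the TARGET ((T1) identity theorem off `P ∪ P′`; (T2) ★
`truncatedFamily_removable_on_of_rows` on `U := Pᶜ` with the removable set `P′`). [cite: MoeglinWaldspurger1995, IV.1.9–IV.1.11] [cite: BernsteinLapid2019, Thm 2.3, §4 p. 10]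
[cite: Conway1978, IV §3 Thm 3.7, V §1] -/
theorem truncatedFamily_transport_of_exports
    (μ : Measure (quasiSplit (↥(maximalRealSubfield L)) L (IsCMField.complexConj L) 3).automorphicQuotient) [SFinite μ]
    (ν : Measure ↥(adelicUnipotent (↥(maximalRealSubfield L)) L (IsCMField.complexConj L) 3)) [ν.IsHaarMeasure]
    {𝓕 : Set ↥(adelicUnipotent (↥(maximalRealSubfield L)) L (IsCMField.complexConj L) 3)}
    (h𝓕N : IsFundamentalDomain ↥(rationalUnipotent (↥(maximalRealSubfield L)) L (IsCMField.complexConj L) 3) 𝓕 ν) (h𝓕c : IsCompact (closure 𝓕)) {T : ℝ≥0} (hT : 1 ≤ T)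
    -- the pair section and the automorphy of `χ₂` (left-`G(F)`-invariance of the continuation off the poles)
    {χ₁ : HeckeCharacter L} {χ₂ : ↥(TorusDict.torus (IsCMField.complexConj L)) →ₜ* ℂˣ}
    {φ : (quasiSplit (↥(maximalRealSubfield L)) L (IsCMField.complexConj L) 3).Adelic → ℂ} (hφ : IsChiSectionPair χ₁ χ₂ φ) (hχ₂ : TorusDict.IsAutomorphic (IsCMField.complexConj L) χ₂)
    -- the TARGET package `(Ec, P)`: tube identity, closed co-discrete candidate set, analyticity ∕ continuity ∕ local joint bound off `P`
    (Ec : ℂ → (quasiSplit (↥(maximalRealSubfield L)) L (IsCMField.complexConj L) 3).Adelic → ℂ) (hE2 : ∀ z : ℂ, 2 < z.re → Ec z = eisensteinSeriesU (flatSectionU φ z))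
    {P : Set ℂ} (hPc : IsClosed P) (hPcd : ∀ z₀ : ℂ, ∀ᶠ s in 𝓝[≠] z₀, s ∉ P)
    (hEan : ∀ g (z : ℂ), z ∉ P → AnalyticAt ℂ (fun z => Ec z g) z) (hE4 : ∀ z : ℂ, z ∉ P → Continuous (Ec z))
    (hEbd : ∀ z₁ : ℂ, z₁ ∉ P → ∀ K : Set (quasiSplit (↥(maximalRealSubfield L)) L (IsCMField.complexConj L) 3).Adelic, IsCompact K → ∃ V ∈ 𝓝 z₁, ∃ M : ℝ, ∀ z ∈ V, ∀ g ∈ K, ‖Ec z g‖ ≤ M)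
    -- the SOURCE package `(Ec′, P′)` with its (E6) truncated `L²` family at level `T` (★ p863930)
    (Ec' : ℂ → (quasiSplit (↥(maximalRealSubfield L)) L (IsCMField.complexConj L) 3).Adelic → ℂ) (hE2' : ∀ z : ℂ, 2 < z.re → Ec' z = eisensteinSeriesU (flatSectionU φ z))
    {P' : Set ℂ} (hPc' : IsClosed P') (hPcd' : ∀ z₀ : ℂ, ∀ᶠ s in 𝓝[≠] z₀, s ∉ P') (hEan' : ∀ g (z : ℂ), z ∉ P' → AnalyticAt ℂ (fun z => Ec' z g) z)
    (Fam' : ℂ → Lp ℂ 2 μ) (hFd' : DifferentiableOn ℂ Fam' P'ᶜ)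
    (hFam' : ∀ z : ℂ, z ∉ P' → ((Fam' z : Lp ℂ 2 μ) : (quasiSplit (↥(maximalRealSubfield L)) L (IsCMField.complexConj L) 3).automorphicQuotient → ℂ) =ᵐ[μ] (quasiSplit (↥(maximalRealSubfield L)) L (IsCMField.complexConj L) 3).quotFun (truncation ν 𝓕 T (Ec' z))) :
    ∃ Fam : ℂ → Lp ℂ 2 μ, DifferentiableOn ℂ Fam Pᶜ ∧
      ∀ z : ℂ, z ∉ P → ((Fam z : Lp ℂ 2 μ) : (quasiSplit (↥(maximalRealSubfield L)) L (IsCMField.complexConj L) 3).automorphicQuotient → ℂ) =ᵐ[μ] (quasiSplit (↥(maximalRealSubfield L)) L (IsCMField.complexConj L) 3).quotFun (truncation ν 𝓕 T (Ec z)) := by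
  -- (T1) the two continuations agree off `P ∪ P′`
  have hEq : ∀ z : ℂ, z ∉ P → z ∉ P' → Ec' z = Ec z := fun z hz hz' =>
    continuation_eq_of_codiscrete hPcd' hPcd hEan' hEan (b := 2) (fun w hw => by rw [hE2' w hw, hE2 w hw]) hz' hz
  -- the target's rows on the open set `U := Pᶜ` (left-invariance ★ `hEcinv_of_codiscrete`)
  have hEcinv := hEcinv_of_codiscrete L hφ hχ₂ hPcd hEan hE2
  have hEd : ∀ g, DifferentiableOn ℂ (fun z => Ec z g) Pᶜ := fun g z hz => (hEan g z hz).differentiableAt.differentiableWithinAt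
  -- (T2) the letter-free shrink on `U := Pᶜ` with the removable set `P′`
  obtain ⟨Fam, hFd, hFam⟩ := truncatedFamily_removable_on_of_rows L μ ν h𝓕N h𝓕c hT Ec hPc' hPcd' hPc.isOpen_compl hEd (fun z hz => hE4 z hz)
    (fun z₁ hz₁ => hEbd z₁ hz₁) (fun z hz => hEcinv z hz) Fam' (hFd'.mono fun z hz => hz.2) fun z hz => by
      rw [← hEq z hz.1 hz.2]; exact hFam' z hz.2
  exact ⟨Fam, hFd, fun z hz => hFam z hz⟩

end Transport

/-! ## §3 THE NAMED INSTANCE: (E6) for `midWitnessEc ∕ midWitnessP` from ★ p863930 — the (V) OF RECORD's `hE6`, `Fam hFd hFam` become witness binders -/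

section Named
variable (L : Type) [Field L] [NumberField L] [IsCMField L] [MeasurableSpace (quasiSplit (↥(maximalRealSubfield L)) L (IsCMField.complexConj L) 3).Adelic] [BorelSpace (quasiSplit (↥(maximalRealSubfield L)) L (IsCMField.complexConj L) 3).Adelic]
  [MeasurableSpace (arch (↥(maximalRealSubfield L)) L (IsCMField.complexConj L) 3 ((StdForm.antidiagonal 3).over L))] [BorelSpace (arch (↥(maximalRealSubfield L)) L (IsCMField.complexConj L) 3 ((StdForm.antidiagonal 3).over L))]
  [MeasurableSpace (finAdelic (↥(maximalRealSubfield L)) L (IsCMField.complexConj L) 3 ((StdForm.antidiagonal 3).over L))] [BorelSpace (finAdelic (↥(maximalRealSubfield L)) L (IsCMField.complexConj L) 3 ((StdForm.antidiagonal 3).over L))]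

/-- **(E6) FOR THE NAMED FAMILY `midWitnessEc` OFF `midWitnessP`, AT EVERY LEVEL `T ≥ 1`** — §2 with the TARGET := the named package (★ `midWitnessExports_spec`, untwisted clauses 5, 7,
8, 10, 14, 15) and the SOURCE := ★ p863930 `chiEisenstein_meromorphic_exports_level_cm_three_with_truncatedFamily` at the SAME M1 data (its (E6) conjunct at level `T`); `χ₂ := 1`
(★ `isAutomorphic_one`, ★ `IsChiSection.isChiSectionPair_of_trivial`).  Binders = the spec's VERBATIM + the level.  CONCLUSION = ★ p863930's (E6) conjunct shape for the named pair:
`∃ Fam, DifferentiableOn ℂ Fam midWitnessPᶜ ∧ ∀ z ∉ midWitnessP, ⇑(Fam z) =ᵐ[μ] quotFun (Λ^T (midWitnessEc z))` — the (V) OF RECORD's `hE6 := fun T hT => (hE6_midWitness … hT).imp fun _ h => h.2`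
and its row-(i′) `Fam hFd hFam` by restriction to `D ⊆ midWitnessPᶜ`. [cite: MoeglinWaldspurger1995, IV.1.9–IV.1.11] [cite: BernsteinLapid2019, Thm 2.3, §4 p. 10] -/
theorem hE6_midWitness
    (μ : Measure (quasiSplit (↥(maximalRealSubfield L)) L (IsCMField.complexConj L) 3).automorphicQuotient) [(quasiSplit (↥(maximalRealSubfield L)) L (IsCMField.complexConj L) 3).IsAutomorphicMeasure μ]
    (νG : Measure (quasiSplit (↥(maximalRealSubfield L)) L (IsCMField.complexConj L) 3).Adelic) [νG.IsHaarMeasure] [νG.IsInvInvariant] [SFinite νG]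
    (ν : Measure ↥(adelicUnipotent (↥(maximalRealSubfield L)) L (IsCMField.complexConj L) 3)) [ν.IsHaarMeasure] [ν.IsMulRightInvariant] [ν.IsInvInvariant]
    {𝓕 : Set ↥(adelicUnipotent (↥(maximalRealSubfield L)) L (IsCMField.complexConj L) 3)}
    (h𝓕N : IsFundamentalDomain ↥(rationalUnipotent (↥(maximalRealSubfield L)) L (IsCMField.complexConj L) 3) 𝓕 ν) (h𝓕c : IsCompact (closure 𝓕)) (h𝓕₀ : ν 𝓕 ≠ 0)
    {β : (quasiSplit (↥(maximalRealSubfield L)) L (IsCMField.complexConj L) 3).Adelic → ℝ≥0∞}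
    (hβ : IsCoveringWeight ↥((arithmeticBorel (↥(maximalRealSubfield L)) L (IsCMField.complexConj L) 3).map (quasiSplit (↥(maximalRealSubfield L)) L (IsCMField.complexConj L) 3).arithmeticSubgroup.subtype) β)
    {μZ : Measure (borelQuotient (↥(maximalRealSubfield L)) L (IsCMField.complexConj L) 3)} [SFinite μZ]
    (hμZ : ∀ f : borelQuotient (↥(maximalRealSubfield L)) L (IsCMField.complexConj L) 3 → ℝ≥0∞, Measurable f → ∫⁻ z, f z ∂μZ = ∫⁻ g, β g * f (toBorelQuotient (↥(maximalRealSubfield L)) L (IsCMField.complexConj L) 3 g) ∂νG)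
    -- the M1 family: `φ ∈ V(χ, K, 1)` continuous bounded with `φ ∘ ι_∞ = φ(1)`, and a basis of `V(χʷ, K, 1)` by continuous bounded functions
    {χ : HeckeCharacter L} {K' : Subgroup (quasiSplit (↥(maximalRealSubfield L)) L (IsCMField.complexConj L) 3).Adelic} {ω : ↥K' → ℂ} {φ : (quasiSplit (↥(maximalRealSubfield L)) L (IsCMField.complexConj L) 3).Adelic → ℂ} (hφV : φ ∈ chiSectionSpace χ K' ω) (hφc : Continuous φ) {Mφ : ℝ} (hφM : ∀ x, ‖φ x‖ ≤ Mφ)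
    -- the LEVEL: `K′ ≤ K`, `ι(K_∞) ⊆ K′`, an open compact `U₀` with `ι_f(U₀ ∩ G_f) ⊆ K′` on which `ω = 1`, continuity of the sections; auxiliary Haar measures on `G_∞` (two-sided) and `G(𝔸_f)`
    (hK' : K' ≤ ((standardMaximalCompactGL 3 L).comap (adelicVal (↥(maximalRealSubfield L)) L (IsCMField.complexConj L) 3 ((StdForm.antidiagonal 3).over L)) : Subgroup (quasiSplit (↥(maximalRealSubfield L)) L (IsCMField.complexConj L) 3).Adelic))
    (hKinf : ∀ k : arch (↥(maximalRealSubfield L)) L (IsCMField.complexConj L) 3 ((StdForm.antidiagonal 3).over L), adelicVal (↥(maximalRealSubfield L)) L (IsCMField.complexConj L) 3 ((StdForm.antidiagonal 3).over L) (archToAdelic (↥(maximalRealSubfield L)) L (IsCMField.complexConj L) 3 _ k) ∈ standardMaximalCompactGL 3 L →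
      archToAdelic (↥(maximalRealSubfield L)) L (IsCMField.complexConj L) 3 _ k ∈ K')
    (U₀ : Subgroup (GL (Fin 3) (FiniteAdeleRing (𝓞 L) L))) (hU₀o : IsOpen (U₀ : Set (GL (Fin 3) (FiniteAdeleRing (𝓞 L) L)))) (hU₀c : IsCompact (U₀ : Set (GL (Fin 3) (FiniteAdeleRing (𝓞 L) L))))
    (hU : ∀ b : finAdelic (↥(maximalRealSubfield L)) L (IsCMField.complexConj L) 3 ((StdForm.antidiagonal 3).over L), (b : GL (Fin 3) (FiniteAdeleRing (𝓞 L) L)) ∈ U₀ →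
      ∃ hb : finAdelicToAdelic (↥(maximalRealSubfield L)) L (IsCMField.complexConj L) 3 ((StdForm.antidiagonal 3).over L) b ∈ K', ω ⟨_, hb⟩ = 1)
    (hVc : ∀ φ ∈ chiSectionSpace χ K' ω, Continuous φ)
    (μa : Measure (arch (↥(maximalRealSubfield L)) L (IsCMField.complexConj L) 3 ((StdForm.antidiagonal 3).over L))) [μa.IsHaarMeasure] [μa.IsMulRightInvariant]
    (μf : Measure (finAdelic (↥(maximalRealSubfield L)) L (IsCMField.complexConj L) 3 ((StdForm.antidiagonal 3).over L))) [μf.IsHaarMeasure]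
    {ι' : Type} [Fintype ι'] [DecidableEq ι'] (bV : Module.Basis ι' ℂ ↥(chiSectionSpace (reflectChar (IsCMField.complexConj L) χ) K' ω))
    (hbc : ∀ j, Continuous ((bV j : ↥(chiSectionSpace (reflectChar (IsCMField.complexConj L) χ) K' ω)) : (quasiSplit (↥(maximalRealSubfield L)) L (IsCMField.complexConj L) 3).Adelic → ℂ)) {Mb : ℝ} (hbM : ∀ j x, ‖((bV j : ↥(chiSectionSpace (reflectChar (IsCMField.complexConj L) χ) K' ω)) : (quasiSplit (↥(maximalRealSubfield L)) L (IsCMField.complexConj L) 3).Adelic → ℂ) x‖ ≤ Mb)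
    (h2 : Module.finrank (↥(maximalRealSubfield L)) L = 2) (hc : IsCMField.complexConj L ≠ 1) (hJ : ((StdForm.antidiagonal 3).over L).det ≠ 0)
    (ψ : ↥(TorusDict.torus (IsCMField.complexConj L)) →ₜ* ℂˣ) (hψ : TorusDict.IsAutomorphic (IsCMField.complexConj L) ψ)
    {T : ℝ≥0} (hT : 1 ≤ T) :
    ∃ Fam : ℂ → Lp ℂ 2 μ, DifferentiableOn ℂ Fam (midWitnessP L μ νG ν h𝓕N h𝓕c h𝓕₀ hβ hμZ hφV hφc hφM hK' hKinf U₀ hU₀o hU₀c hU hVc μa μf bV hbc hbM h2 hc hJ ψ hψ)ᶜ ∧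
      ∀ z : ℂ, z ∉ midWitnessP L μ νG ν h𝓕N h𝓕c h𝓕₀ hβ hμZ hφV hφc hφM hK' hKinf U₀ hU₀o hU₀c hU hVc μa μf bV hbc hbM h2 hc hJ ψ hψ →
        ((Fam z : Lp ℂ 2 μ) : (quasiSplit (↥(maximalRealSubfield L)) L (IsCMField.complexConj L) 3).automorphicQuotient → ℂ) =ᵐ[μ]
          (quasiSplit (↥(maximalRealSubfield L)) L (IsCMField.complexConj L) 3).quotFun (truncation ν 𝓕 T (midWitnessEc L μ νG ν h𝓕N h𝓕c h𝓕₀ hβ hμZ hφV hφc hφM hK' hKinf U₀ hU₀o hU₀c hU hVc μa μf bV hbc hbM h2 hc hJ ψ hψ z)) := by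
  -- the TARGET clauses of the named package (★ `midWitnessExports_spec`: 5 tube identity, 7 closed, 8 co-discrete, 10 analytic, 14 continuous, 15 locally bounded)
  obtain ⟨-, -, -, -, hE2, -, hPc, hPcd, -, hEan, -, -, -, hE4, hEbd, -⟩ := midWitnessExports_spec L μ νG ν h𝓕N h𝓕c h𝓕₀ hβ hμZ hφV hφc hφM hK' hKinf U₀ hU₀o hU₀c hU hVc μa μf bV hbc hbM h2 hc hJ ψ hψ
  -- the SOURCE package with its (E6) family at level `T` (★ p863930 at the same M1 data)
  obtain ⟨-, Ec', -, P', -, -, -, -, hE2', -, hPc', hPcd', -, hEan', -, -, -, -, -, hE6'⟩ :=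
    chiEisenstein_meromorphic_exports_level_cm_three_with_truncatedFamily L μ νG ν h𝓕N h𝓕c h𝓕₀ hβ hμZ hφV hφc hφM hK' hKinf U₀ hU₀o hU₀c hU hVc μa μf bV hbc hbM
  obtain ⟨Fam', hFd', hFam'⟩ := hE6' T hT
  exact truncatedFamily_transport_of_exports L μ ν h𝓕N h𝓕c hT
    (IsChiSection.isChiSectionPair_of_trivial (one_apply_torus (IsCMField.complexConj L)) (isChiSection_of_mem hφV)) (isAutomorphic_one (IsCMField.complexConj L))
    (midWitnessEc L μ νG ν h𝓕N h𝓕c h𝓕₀ hβ hμZ hφV hφc hφM hK' hKinf U₀ hU₀o hU₀c hU hVc μa μf bV hbc hbM h2 hc hJ ψ hψ) hE2 hPc hPcd hEan hE4 hEbd Ec' hE2' hPc' hPcd' hEan' Fam' hFd' hFam'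

end Named

end Summit.HodgeConjecture.HodgeConjecture.Cruxes.H413.K2E1ChiTruncatedFamilyTransportCMThree

end
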